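import Summits.KontsevichZagierPeriods.KontsevichZagierPeriods.Theses.HurwitzMicroSectors

/-!
# Crux `HurwitzSectorComplement` (stmt-KontsevichZagierPeriods-14341), line `galois-parity-half`:
# stub `stub_pairValueAlgebraic` — the symmetric Hurwitz values are algebraic multiples of `π^w`

For `w ≥ 2` and `0 < a < L` put
`K(w,L,a) := Σ_{k ≥ 0} (Lk+a)^{-w} + (-1)^w Σ_{k ≥ 0} (Lk+L-a)^{-w}`
(`= L^{-w}(ζ(w,a/L) + (-1)^w ζ(w,1-a/L))`), the value kernel of the normal forms of the line.
We prove `K(w,L,a)/π^w ∈ ℚ̄` by real finite Fourier analysis, Mathlib-only: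

1. `K(w,L,a) = Σ'_{n} (𝟙(n ≡ a mod L) + (-1)^w 𝟙(n ≡ -a mod L)) n^{-w}` (reindexing `n = Lk + a`,
   `n = Lk + (L - a)`: `tsum_arithProg_eq_tsum_ite`);
2. the indicator of a residue class is a cosine sum, `Σ_{j<L} cos(2πjm/L) = L·𝟙(L ∣ m)`
   (real part of a geometric sum of `L`-th roots of unity: `sum_range_cexp_eq_ite`,
   `sum_range_cos_eq_ite`, `ite_mod_eq_eq_sum_cos`, `ite_mod_eq_sub_eq_sum_cos`);
3. parity: `cos(x-y) + cos(x+y) = 2cos x cos y`, `cos(x-y) - cos(x+y) = 2 sin x sin y`, whence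
   `K(w,L,a) = (2/L) Σ_{j<L} cos(2πja/L) C_w(j/L)` for even `w` and
   `K(w,L,a) = (2/L) Σ_{j<L} sin(2πja/L) S_w(j/L)` for odd `w`, with the Bernoulli–Fourier sums
   `C_w(x) = Σ'_n cos(2πnx)/n^w`, `S_w(x) = Σ'_n sin(2πnx)/n^w` (`symHurwitz_eq_trig_sum`);
4. Mathlib's closed forms (`hasSum_one_div_nat_pow_mul_cos/sin`, file `NumberTheory/ZetaValues`):
   `C_{2k}(x)`, `S_{2k+1}(x)` are Bernoulli polynomials over `ℚ` in `x` times `π^w`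
   (`trigSum_cos_closed`, `trigSum_sin_closed`; at `x = j/L`: `trigSum_cos_rat`, `trigSum_sin_rat`);
5. `cos(2πja/L)`, `sin(2πja/L)` are algebraic (Mathlib `Real.isAlgebraic_cos_rat_mul_pi`, Niven file),
   so `K(w,L,a)/π^w = (2/L) Σ_j (algebraic)·(rational)` is algebraic (`isAlgebraic_trig_comb`).

No new definitions; the helpers live in the sub-namespace `PairValueAlgebraic`.
-/

noncomputable section

open Set MeasureTheory
open scoped BigOperators Nat
open Literature.NumberTheory.Transcendental
open Real

namespace Summit.KontsevichZagierPeriods.Theorems.HurwitzMicroSectorsHurwitzSectorComplement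

namespace PairValueAlgebraic

/-! ### Step 1: sums over an arithmetic progression as indicator sums -/

/-- Reindexing `n = Lk + r` (`r < L`): `Σ_k (Lk+r)^{-w} = Σ'_n 𝟙(n % L = r) n^{-w}`. [folklore] -/
theorem tsum_arithProg_eq_tsum_ite (L r w : ℕ) (hr : r < L) :
    ∑' k : ℕ, 1 / ((L : ℝ) * k + r) ^ w = ∑' n : ℕ, (if n % L = r then 1 / (n : ℝ) ^ w else 0) := by
  have hL : 0 < L := by omega
  have hinj : Function.Injective (fun k : ℕ => L * k + r) := by
    intro x y hxy
    exact Nat.eq_of_mul_eq_mul_left hL (Nat.add_right_cancel hxy)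
  have key := hinj.tsum_eq (f := fun n : ℕ => if n % L = r then 1 / (n : ℝ) ^ w else 0) ?_
  · rw [← key]
    refine tsum_congr fun k => ?_
    simp only [Nat.mul_add_mod, Nat.mod_eq_of_lt hr, if_true]
    push_cast
    ring
  · intro n hn
    rw [Function.mem_support] at hn
    have hmod : n % L = r := by
      by_contra h
      exact hn (if_neg h)
    exact ⟨n / L, by rw [← hmod]; exact Nat.div_add_mod n L⟩

/-- The indicator series `Σ'_n 𝟙(n % L = r) n^{-w}` is summable for `w > 1`. [folklore] -/
theorem summable_ite_mod (L r w : ℕ) (hw : 1 < w) :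
    Summable (fun n : ℕ => if n % L = r then 1 / (n : ℝ) ^ w else 0) := by
  refine Summable.of_nonneg_of_le (fun n => ?_) (fun n => ?_)
    (Real.summable_one_div_nat_pow.mpr hw)
  · split_ifs <;> positivity
  · split_ifs
    · exact le_rfl
    · positivity

/-- `n ↦ cos(2πnx)/n^w` is summable for `w > 1`. [folklore] -/
theorem summable_cos_div (w : ℕ) (hw : 1 < w) (x : ℝ) :
    Summable (fun n : ℕ => 1 / (n : ℝ) ^ w * Real.cos (2 * π * n * x)) := by
  refine Summable.of_norm_bounded (Real.summable_one_div_nat_pow.mpr hw) (fun n => ?_)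
  rw [norm_mul, Real.norm_eq_abs, Real.norm_eq_abs,
    abs_of_nonneg (by positivity : (0 : ℝ) ≤ 1 / (n : ℝ) ^ w)]
  exact mul_le_of_le_one_right (by positivity) (Real.abs_cos_le_one _)

/-- `n ↦ sin(2πnx)/n^w` is summable for `w > 1`. [folklore] -/
theorem summable_sin_div (w : ℕ) (hw : 1 < w) (x : ℝ) :
    Summable (fun n : ℕ => 1 / (n : ℝ) ^ w * Real.sin (2 * π * n * x)) := by
  refine Summable.of_norm_bounded (Real.summable_one_div_nat_pow.mpr hw) (fun n => ?_)
  rw [norm_mul, Real.norm_eq_abs, Real.norm_eq_abs,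
    abs_of_nonneg (by positivity : (0 : ℝ) ≤ 1 / (n : ℝ) ^ w)]
  exact mul_le_of_le_one_right (by positivity) (Real.abs_sin_le_one _)

/-! ### Step 2: indicators of residue classes as cosine sums -/

/-- Orthogonality of the `L`-th roots of unity: `Σ_{j<L} e^{2πi mj/L} = L·𝟙(L ∣ m)`. [folklore] -/
theorem sum_range_cexp_eq_ite (L : ℕ) (hL : L ≠ 0) (m : ℤ) :
    ∑ j ∈ Finset.range L, Complex.exp (2 * π * Complex.I * m * j / L) =
      if (L : ℤ) ∣ m then (L : ℂ) else 0 := by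
  have hL' : (L : ℂ) ≠ 0 := Nat.cast_ne_zero.mpr hL
  have h2πI : (2 * π * Complex.I : ℂ) ≠ 0 := by
    simp [Real.pi_ne_zero, Complex.I_ne_zero]
  set z : ℂ := Complex.exp (2 * π * Complex.I * m / L) with hz
  have hzj : ∀ j : ℕ, Complex.exp (2 * π * Complex.I * m * j / L) = z ^ j := by
    intro j
    rw [hz, ← Complex.exp_nat_mul]
    congr 1
    ring
  simp_rw [hzj]
  by_cases hdvd : (L : ℤ) ∣ m
  · rw [if_pos hdvd]
    obtain ⟨t, rfl⟩ := hdvd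
    have hz1 : z = 1 := by
      rw [hz, Complex.exp_eq_one_iff]
      refine ⟨t, ?_⟩
      rw [div_eq_iff hL']
      push_cast
      ring
    simp [hz1]
  · rw [if_neg hdvd]
    have hz1 : z ≠ 1 := by
      intro h1
      rw [hz, Complex.exp_eq_one_iff] at h1
      obtain ⟨t, ht⟩ := h1
      rw [div_eq_iff hL'] at ht
      apply hdvd
      refine ⟨t, ?_⟩
      have : (m : ℂ) = L * t := by
        apply mul_left_cancel₀ h2πI
        linear_combination ht
      exact_mod_cast this
    have hzL : z ^ L = 1 := by
      rw [hz, ← Complex.exp_nat_mul, Complex.exp_eq_one_iff]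
      refine ⟨m, ?_⟩
      rw [mul_comm, div_mul_cancel₀ _ hL']
      ring
    rw [geom_sum_eq hz1, hzL, sub_self, zero_div]

/-- Real form: `Σ_{j<L} cos(2πjm/L) = L·𝟙(L ∣ m)` for `m ∈ ℤ`. [folklore] -/
theorem sum_range_cos_eq_ite (L : ℕ) (hL : L ≠ 0) (m : ℤ) :
    ∑ j ∈ Finset.range L, Real.cos (2 * π * j * m / L) = if (L : ℤ) ∣ m then (L : ℝ) else 0 := by
  have h := congrArg Complex.re (sum_range_cexp_eq_ite L hL m)
  rw [Complex.re_sum] at h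
  convert h using 1
  · refine Finset.sum_congr rfl fun j _ => ?_
    rw [show (2 * π * Complex.I * m * j / L : ℂ) = ((2 * π * j * m / L : ℝ) : ℂ) * Complex.I by
      push_cast; ring]
    exact (Complex.exp_ofReal_mul_I_re _).symm
  · split_ifs <;> simp

/-- `𝟙(n ≡ a mod L) = (1/L) Σ_{j<L} cos(2πj(n-a)/L)` for `a < L`. [folklore] -/
theorem ite_mod_eq_eq_sum_cos (L a n : ℕ) (haL : a < L) :
    (if n % L = a then (1 : ℝ) else 0) =
      1 / L * ∑ j ∈ Finset.range L, Real.cos (2 * π * j * ((n : ℝ) - a) / L) := by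
  have hL : L ≠ 0 := by omega
  have h := sum_range_cos_eq_ite L hL ((n : ℤ) - a)
  push_cast at h
  rw [h]
  have key : n % L = a ↔ (L : ℤ) ∣ (n : ℤ) - a := by
    rw [← Nat.modEq_iff_dvd]
    unfold Nat.ModEq
    rw [Nat.mod_eq_of_lt haL]
    exact eq_comm
  by_cases hn : n % L = a
  · rw [if_pos hn, if_pos (key.mp hn)]
    field_simp
  · rw [if_neg hn, if_neg (fun h => hn (key.mpr h)), mul_zero]

/-- `𝟙(n ≡ -a mod L) = (1/L) Σ_{j<L} cos(2πj(n+a)/L)` for `0 < a < L`. [folklore] -/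
theorem ite_mod_eq_sub_eq_sum_cos (L a n : ℕ) (ha : 0 < a) (haL : a < L) :
    (if n % L = L - a then (1 : ℝ) else 0) =
      1 / L * ∑ j ∈ Finset.range L, Real.cos (2 * π * j * ((n : ℝ) + a) / L) := by
  have hL : L ≠ 0 := by omega
  have h := sum_range_cos_eq_ite L hL ((n + a : ℕ) : ℤ)
  push_cast at h
  rw [h]
  have key : n % L = L - a ↔ L ∣ n + a := by
    have h1 : (L - a) % L = L - a := Nat.mod_eq_of_lt (Nat.sub_lt (by omega) ha)
    have h0 : L ≡ 0 [MOD L] := by simp [Nat.ModEq]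
    constructor
    · intro h
      have h2 : n ≡ L - a [MOD L] := by unfold Nat.ModEq; rw [h, h1]
      have h3 := h2.add_right a
      rw [Nat.sub_add_cancel haL.le] at h3
      exact Nat.modEq_zero_iff_dvd.mp (h3.trans h0)
    · intro h
      have h3 : n + a ≡ L - a + a [MOD L] := by
        rw [Nat.sub_add_cancel haL.le]
        exact (Nat.modEq_zero_iff_dvd.mpr h).trans h0.symm
      have h2 := Nat.ModEq.add_right_cancel' a h3
      unfold Nat.ModEq at h2
      rw [h2, h1]
  have key' : n % L = L - a ↔ (L : ℤ) ∣ (n : ℤ) + a := by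
    rw [key, ← Int.natCast_dvd_natCast, Nat.cast_add]
  by_cases hn : n % L = L - a
  · rw [if_pos hn, if_pos (key'.mp hn)]
    field_simp
  · rw [if_neg hn, if_neg (fun h => hn (key'.mpr h)), mul_zero]

/-! ### Step 3: parity split, termwise -/

/-- The parity-split Fourier expansion of one term of `K(w,L,a)`. [folklore] -/
theorem term_eq_trig (w L a n : ℕ) (ha : 0 < a) (haL : a < L) :
    (if n % L = a then 1 / (n : ℝ) ^ w else 0) +
        (-1 : ℝ) ^ w * (if n % L = L - a then 1 / (n : ℝ) ^ w else 0) =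
      if Even w then
        2 / L * ∑ j ∈ Finset.range L,
          Real.cos (2 * π * j * a / L) * (1 / (n : ℝ) ^ w * Real.cos (2 * π * n * ((j : ℝ) / L)))
      else
        2 / L * ∑ j ∈ Finset.range L,
          Real.sin (2 * π * j * a / L) * (1 / (n : ℝ) ^ w * Real.sin (2 * π * n * ((j : ℝ) / L))) := by
  have e1 : (if n % L = a then 1 / (n : ℝ) ^ w else 0) =
      (if n % L = a then (1 : ℝ) else 0) * (1 / (n : ℝ) ^ w) := by rw [boole_mul]
  have e2 : (if n % L = L - a then 1 / (n : ℝ) ^ w else 0) =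
      (if n % L = L - a then (1 : ℝ) else 0) * (1 / (n : ℝ) ^ w) := by rw [boole_mul]
  rw [e1, e2, ite_mod_eq_eq_sum_cos L a n haL, ite_mod_eq_sub_eq_sum_cos L a n ha haL]
  have hc : ∀ j : ℕ, Real.cos (2 * π * j * ((n : ℝ) - a) / L) =
      Real.cos (2 * π * n * ((j : ℝ) / L)) * Real.cos (2 * π * j * a / L) +
        Real.sin (2 * π * n * ((j : ℝ) / L)) * Real.sin (2 * π * j * a / L) := by
    intro j
    rw [← Real.cos_sub]
    congr 1
    ring
  have hc' : ∀ j : ℕ, Real.cos (2 * π * j * ((n : ℝ) + a) / L) =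
      Real.cos (2 * π * n * ((j : ℝ) / L)) * Real.cos (2 * π * j * a / L) -
        Real.sin (2 * π * n * ((j : ℝ) / L)) * Real.sin (2 * π * j * a / L) := by
    intro j
    rw [← Real.cos_add]
    congr 1
    ring
  rcases Nat.even_or_odd w with hw | hw
  · rw [if_pos hw, hw.neg_one_pow]
    simp only [Finset.mul_sum, Finset.sum_mul, ← Finset.sum_add_distrib]
    refine Finset.sum_congr rfl fun j _ => ?_
    rw [hc j, hc' j]
    ring
  · rw [if_neg (Nat.not_even_iff_odd.mpr hw), hw.neg_one_pow]
    simp only [Finset.mul_sum, Finset.sum_mul, ← Finset.sum_add_distrib]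
    refine Finset.sum_congr rfl fun j _ => ?_
    rw [hc j, hc' j]
    ring

/-! ### Steps 1–4 assembled: the trigonometric form of `K(w,L,a)` -/

/-- **Trigonometric (Bernoulli–Fourier) form of the symmetric Hurwitz values.** For `w ≥ 2`,
`0 < a < L`:
`Σ_k (Lk+a)^{-w} + (-1)^w Σ_k (Lk+L-a)^{-w} = (2/L) Σ_{j<L} cos(2πja/L) Σ'_n cos(2πnj/L)/n^w` (`w` even),
`= (2/L) Σ_{j<L} sin(2πja/L) Σ'_n sin(2πnj/L)/n^w` (`w` odd). [folklore] -/
theorem symHurwitz_eq_trig_sum (w L a : ℕ) (hw : 2 ≤ w) (ha : 0 < a) (haL : a < L) :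
    (∑' k : ℕ, 1 / ((L : ℝ) * k + a) ^ w) +
        (-1 : ℝ) ^ w * (∑' k : ℕ, 1 / ((L : ℝ) * k + ((L : ℝ) - a)) ^ w) =
      if Even w then
        2 / L * ∑ j ∈ Finset.range L,
          Real.cos (2 * π * j * a / L) * ∑' n : ℕ, 1 / (n : ℝ) ^ w * Real.cos (2 * π * n * ((j : ℝ) / L))
      else
        2 / L * ∑ j ∈ Finset.range L,
          Real.sin (2 * π * j * a / L) *
            ∑' n : ℕ, 1 / (n : ℝ) ^ w * Real.sin (2 * π * n * ((j : ℝ) / L)) := by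
  have hw1 : 1 < w := by omega
  rw [← Nat.cast_sub haL.le, tsum_arithProg_eq_tsum_ite L a w haL,
    tsum_arithProg_eq_tsum_ite L (L - a) w (by omega), ← tsum_mul_left,
    ← (summable_ite_mod L a w hw1).tsum_add ((summable_ite_mod L (L - a) w hw1).mul_left _),
    tsum_congr (fun n => term_eq_trig w L a n ha haL)]
  rcases Nat.even_or_odd w with hw' | hw'
  · simp only [if_pos hw']
    rw [tsum_mul_left, Summable.tsum_finsetSum (fun j _ => (summable_cos_div w hw1 _).mul_left _)]
    congr 1
    exact Finset.sum_congr rfl fun j _ => tsum_mul_left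
  · simp only [if_neg (Nat.not_even_iff_odd.mpr hw')]
    rw [tsum_mul_left, Summable.tsum_finsetSum (fun j _ => (summable_sin_div w hw1 _).mul_left _)]
    congr 1
    exact Finset.sum_congr rfl fun j _ => tsum_mul_left

/-! ### Step 5: Mathlib's closed forms of the Bernoulli–Fourier sums -/

/-- `Σ'_n cos(2πnx)/n^{2k} = (-1)^{k+1} (2π)^{2k}/(2·(2k)!) · B_{2k}(x)` on `[0,1]` (`k ≥ 1`);
Mathlib's `hasSum_one_div_nat_pow_mul_cos`. [folklore] -/
theorem trigSum_cos_closed {k : ℕ} (hk : k ≠ 0) {x : ℝ} (hx : x ∈ Set.Icc (0 : ℝ) 1) :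
    ∑' n : ℕ, 1 / (n : ℝ) ^ (2 * k) * Real.cos (2 * π * n * x) =
      (-1) ^ (k + 1) * (2 * π) ^ (2 * k) / 2 / (2 * k)! *
        (Polynomial.map (algebraMap ℚ ℝ) (Polynomial.bernoulli (2 * k))).eval x :=
  (hasSum_one_div_nat_pow_mul_cos hk hx).tsum_eq

/-- `Σ'_n sin(2πnx)/n^{2k+1} = (-1)^{k+1} (2π)^{2k+1}/(2·(2k+1)!) · B_{2k+1}(x)` on `[0,1]` (`k ≥ 1`);
Mathlib's `hasSum_one_div_nat_pow_mul_sin`. [folklore] -/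
theorem trigSum_sin_closed {k : ℕ} (hk : k ≠ 0) {x : ℝ} (hx : x ∈ Set.Icc (0 : ℝ) 1) :
    ∑' n : ℕ, 1 / (n : ℝ) ^ (2 * k + 1) * Real.sin (2 * π * n * x) =
      (-1) ^ (k + 1) * (2 * π) ^ (2 * k + 1) / 2 / (2 * k + 1)! *
        (Polynomial.map (algebraMap ℚ ℝ) (Polynomial.bernoulli (2 * k + 1))).eval x :=
  (hasSum_one_div_nat_pow_mul_sin hk hx).tsum_eq

/-- At a rational point `x = j/L ∈ [0,1]` the cosine sum is an explicit rational times `π^{2k}`.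
[folklore] -/
theorem trigSum_cos_rat {k : ℕ} (hk : k ≠ 0) {L j : ℕ} (hL : L ≠ 0) (hj : j ≤ L) :
    ∑' n : ℕ, 1 / (n : ℝ) ^ (2 * k) * Real.cos (2 * π * n * ((j : ℝ) / L)) =
      (((-1) ^ (k + 1) * 2 ^ (2 * k) / 2 / (2 * k)! *
          (Polynomial.bernoulli (2 * k)).eval ((j : ℚ) / L) : ℚ) : ℝ) * π ^ (2 * k) := by
  have hL' : (0 : ℝ) < L := by positivity
  have hx : ((j : ℝ) / L) ∈ Set.Icc (0 : ℝ) 1 :=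
    ⟨by positivity, div_le_one_of_le₀ (by exact_mod_cast hj) hL'.le⟩
  rw [trigSum_cos_closed hk hx,
    show ((j : ℝ) / L) = algebraMap ℚ ℝ ((j : ℚ) / L) by rw [eq_ratCast]; push_cast; rfl,
    Polynomial.eval_map, Polynomial.eval₂_at_apply, eq_ratCast]
  push_cast
  ring

/-- At a rational point `x = j/L ∈ [0,1]` the sine sum is an explicit rational times `π^{2k+1}`.
[folklore] -/
theorem trigSum_sin_rat {k : ℕ} (hk : k ≠ 0) {L j : ℕ} (hL : L ≠ 0) (hj : j ≤ L) :
    ∑' n : ℕ, 1 / (n : ℝ) ^ (2 * k + 1) * Real.sin (2 * π * n * ((j : ℝ) / L)) =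
      (((-1) ^ (k + 1) * 2 ^ (2 * k + 1) / 2 / (2 * k + 1)! *
          (Polynomial.bernoulli (2 * k + 1)).eval ((j : ℚ) / L) : ℚ) : ℝ) * π ^ (2 * k + 1) := by
  have hL' : (0 : ℝ) < L := by positivity
  have hx : ((j : ℝ) / L) ∈ Set.Icc (0 : ℝ) 1 :=
    ⟨by positivity, div_le_one_of_le₀ (by exact_mod_cast hj) hL'.le⟩
  rw [trigSum_sin_closed hk hx,
    show ((j : ℝ) / L) = algebraMap ℚ ℝ ((j : ℚ) / L) by rw [eq_ratCast]; push_cast; rfl,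
    Polynomial.eval_map, Polynomial.eval₂_at_apply, eq_ratCast]
  push_cast
  ring

/-! ### Step 6: algebraicity of the coefficients and assembly -/

/-- `cos(2πja/L)` is algebraic (Mathlib: `Real.isAlgebraic_cos_rat_mul_pi`). [folklore] -/
theorem isAlgebraic_cos_two_pi_mul (j a L : ℕ) :
    IsAlgebraic ℚ (Real.cos (2 * π * j * a / L)) := by
  have h := (Real.isAlgebraic_cos_rat_mul_pi (2 * j * a / L)).extendScalars
    (R := ℤ) (S := ℚ) (A := ℝ) (RingHom.injective_int (algebraMap ℤ ℚ))
  convert h using 2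
  push_cast
  ring

/-- `sin(2πja/L)` is algebraic (Mathlib: `Real.isAlgebraic_sin_rat_mul_pi`). [folklore] -/
theorem isAlgebraic_sin_two_pi_mul (j a L : ℕ) :
    IsAlgebraic ℚ (Real.sin (2 * π * j * a / L)) := by
  have h := (Real.isAlgebraic_sin_rat_mul_pi (2 * j * a / L)).extendScalars
    (R := ℤ) (S := ℚ) (A := ℝ) (RingHom.injective_int (algebraMap ℤ ℚ))
  convert h using 2
  push_cast
  ring

/-- Assembly: `(2/L) Σ_{j<L} c_j T_j / π^w` is algebraic when the `c_j` are algebraic and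
`T_j = q_j π^w` with `q_j ∈ ℚ`. [folklore] -/
theorem isAlgebraic_trig_comb (L w : ℕ) (c T : ℕ → ℝ) (q : ℕ → ℚ)
    (hc : ∀ j ∈ Finset.range L, IsAlgebraic ℚ (c j))
    (hT : ∀ j ∈ Finset.range L, T j = (q j : ℝ) * π ^ w) :
    IsAlgebraic ℚ (2 / (L : ℝ) * (∑ j ∈ Finset.range L, c j * T j) / π ^ w) := by
  have hπ : (π : ℝ) ^ w ≠ 0 := pow_ne_zero _ Real.pi_ne_zero
  have e : 2 / (L : ℝ) * (∑ j ∈ Finset.range L, c j * T j) / π ^ w =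
      2 / (L : ℝ) * ∑ j ∈ Finset.range L, c j * (q j : ℝ) := by
    rw [mul_div_assoc, Finset.sum_div]
    congr 1
    refine Finset.sum_congr rfl fun j hj => ?_
    rw [hT j hj, ← mul_assoc, mul_div_cancel_right₀ _ hπ]
  rw [e]
  refine IsAlgebraic.mul ?_ ?_
  · have h := isAlgebraic_rat ℚ (A := ℝ) ((2 : ℚ) / L)
    push_cast at h
    exact h
  · have hmem : ∀ j ∈ Finset.range L, c j * (q j : ℝ) ∈ Subalgebra.algebraicClosure ℚ ℝ :=
      fun j hj => show IsAlgebraic ℚ _ from (hc j hj).mul (isAlgebraic_rat ℚ (q j))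
    exact (Subalgebra.algebraicClosure ℚ ℝ).sum_mem hmem

end PairValueAlgebraic

/-- **S3 (the symmetric Hurwitz values are algebraic multiples of `π^w`).**
`K(w,L,a)/π^w ∈ ℚ̄` (indeed `∈ i^w ℚ(ζ_L)`: Bernoulli–Fourier series). [folklore] -/
theorem stub_pairValueAlgebraic : ∀ (w L a : ℕ), 2 ≤ w → 0 < a → a < L → IsAlgebraic ℚ (((∑' k : ℕ, 1 / ((L : ℝ) * k + a) ^ w) + (-1 : ℝ) ^ w * (∑' k : ℕ, 1 / ((L : ℝ) * k + ((L : ℝ) - a)) ^ w)) / Real.pi ^ w) := by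
  intro w L a hw ha haL
  have hL : L ≠ 0 := by omega
  rw [PairValueAlgebraic.symHurwitz_eq_trig_sum w L a hw ha haL]
  obtain ⟨m, rfl | rfl⟩ := Nat.even_or_odd' w
  · have hm : m ≠ 0 := by omega
    rw [if_pos (even_two_mul m)]
    exact PairValueAlgebraic.isAlgebraic_trig_comb L (2 * m) (fun j => Real.cos (2 * π * j * a / L))
      (fun j => ∑' n : ℕ, 1 / (n : ℝ) ^ (2 * m) * Real.cos (2 * π * n * ((j : ℝ) / L))) _
      (fun j _ => PairValueAlgebraic.isAlgebraic_cos_two_pi_mul j a L)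
      (fun j hj => PairValueAlgebraic.trigSum_cos_rat hm hL (Finset.mem_range.mp hj).le)
  · have hm : m ≠ 0 := by omega
    rw [if_neg (Nat.not_even_iff_odd.mpr (odd_two_mul_add_one m))]
    exact PairValueAlgebraic.isAlgebraic_trig_comb L (2 * m + 1)
      (fun j => Real.sin (2 * π * j * a / L))
      (fun j => ∑' n : ℕ, 1 / (n : ℝ) ^ (2 * m + 1) * Real.sin (2 * π * n * ((j : ℝ) / L))) _
      (fun j _ => PairValueAlgebraic.isAlgebraic_sin_two_pi_mul j a L)
      (fun j hj => PairValueAlgebraic.trigSum_sin_rat hm hL (Finset.mem_range.mp hj).le)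

end Summit.KontsevichZagierPeriods.Theorems.HurwitzMicroSectorsHurwitzSectorComplement

end
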